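import Literature.NumberTheory.GaloisRepresentations.GaloisRep
import Literature.NumberTheory.GaloisRepresentations.ArtinLFunction
import HarnessLib

/-!
# `ArtinWeightRealisationLevel` (item stmt-Langlands-15111 of route ParityBlindBianchi), twist
# sector: transport of a finite-order `p`-adic character to a rank-one Artin representation

Stub `stub_existsCharacterTransport` of the line `Sketch`.  For a field `K`, a field isomorphism
`ι : ℚ̄_p ≃+* ℂ` and a continuous character `ψ : Γ_K →ₜ* ℚ̄_pˣ` with finite image, the
homomorphism `g ↦ (ι (ψ g))⁻¹ : Γ_K → ℂˣ ≅ GL_1(ℂ)` is continuous — its kernel contains the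
kernel of `ψ`, which is closed (preimage of the closed point `1`) of finite index (the quotient is
the finite image), hence open — so it is a rank-one framed Artin representation `τ` with
`(τ g)₀₀ = ι(ψ g)⁻¹`.  (The field isomorphism `ι` is not continuous; continuity comes from the
finite image only.)

Reference: J.-P. Serre, *Abelian ℓ-adic representations and elliptic curves* (1968), Ch. I §1.1,
Ch. III §2.3 (representations with finite image are continuous for any coefficient topology).
-/

noncomputable section

set_option linter.dupNamespace false -- `Summit.Langlands.Langlands` is the mandated namespace (D-0017)

open Field Literature.NumberTheory.GaloisRepresentations

namespace Summit.Langlands.Langlands.Theorems.ArtinWeightRealisationLevel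

/-- A group homomorphism out of a topological group whose kernel is open is continuous (the
preimage of any set is a union of cosets of the kernel).  Private copy of the tree's
`MonoidHom.continuous_of_isOpen_ker` (`Literature.NumberTheory.Automorphic.LanglandsTetrahedral`),
kept here to keep the imports light. [folklore] -/
private theorem continuous_of_isOpen_ker {G H : Type*} [Group G] [TopologicalSpace G]
    [IsTopologicalGroup G] [Group H] [TopologicalSpace H] [ContinuousMul H] (f : G →* H)
    (hf : IsOpen (f.ker : Set G)) : Continuous f := by
  apply continuous_of_continuousAt_one f
  rw [ContinuousAt, map_one]
  intro U hU
  rw [Filter.mem_map]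
  apply Filter.mem_of_superset (hf.mem_nhds (by simp))
  intro g hg
  rw [SetLike.mem_coe, MonoidHom.mem_ker] at hg
  rw [Set.mem_preimage, hg]
  exact mem_of_mem_nhds hU

/-- A continuous homomorphism `ψ : Γ_K →ₜ* M` into a `T₁` topological group with finite image has
open kernel: the kernel is closed (preimage of the closed point `1`) and of finite index (the
quotient by the kernel is the finite image).  Serre, *Abelian ℓ-adic representations* (1968),
Ch. I §1.1. [folklore] -/
private theorem isOpen_ker_of_finite_range {K : Type*} [Field K] {M : Type*} [Group M]
    [TopologicalSpace M] [T1Space M] (ψ : absoluteGaloisGroup K →ₜ* M)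
    [Finite ψ.toMonoidHom.range] : IsOpen (ψ.toMonoidHom.ker : Set (absoluteGaloisGroup K)) := by
  have hclosed : IsClosed (ψ.toMonoidHom.ker : Set (absoluteGaloisGroup K)) := by
    have : (ψ.toMonoidHom.ker : Set (absoluteGaloisGroup K)) = ψ ⁻¹' {1} := by
      ext; simp [MonoidHom.mem_ker]
    rw [this]
    exact (isClosed_singleton).preimage ψ.continuous_toFun
  haveI : Finite (absoluteGaloisGroup K ⧸ ψ.toMonoidHom.ker) :=
    Finite.of_equiv _ (QuotientGroup.quotientKerEquivRange ψ.toMonoidHom).symm.toEquiv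
  haveI : ψ.toMonoidHom.ker.FiniteIndex := Subgroup.finiteIndex_of_finite_quotient
  exact Subgroup.isOpen_of_isClosed_of_finiteIndex _ hclosed

/-- **Transport of a finite-order `p`-adic character to a rank-one Artin representation.**  For a
field isomorphism `ι : ℚ̄_p ≃+* ℂ` and a continuous character `ψ : Γ_K →ₜ* ℚ̄_pˣ` with finite
image, there is a rank-one framed Artin representation `τ : Γ_K →ₜ* GL_1(ℂ)` with
`(τ g)₀₀ = ι(ψ g)⁻¹` for all `g` (the homomorphism `g ↦ ι(ψ g)⁻¹` is continuous because its
kernel contains the open kernel of `ψ`).  Serre, *Abelian ℓ-adic representations* (1968),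
Ch. I §1.1, Ch. III §2.3. [folklore] -/
theorem stub_existsCharacterTransport : ∀ (K : Type) [Field K] (p : ℕ) [Fact p.Prime] (ι : PadicAlgCl p ≃+* ℂ) (ψ : Field.absoluteGaloisGroup K →ₜ* (PadicAlgCl p)ˣ), Finite ψ.toMonoidHom.range → ∃ τ : Literature.NumberTheory.GaloisRepresentations.FramedArtinRep K 1, ∀ g : Field.absoluteGaloisGroup K, ((τ g : GL (Fin 1) ℂ) : Matrix (Fin 1) (Fin 1) ℂ) 0 0 = (ι ((ψ g : (PadicAlgCl p)ˣ) : PadicAlgCl p))⁻¹ := by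
  intro K _ p _ ι ψ hfin
  -- the transported, inverted character `g ↦ (ι (ψ g))⁻¹ : Γ_K →* ℂˣ`
  set θ : absoluteGaloisGroup K →* ℂˣ :=
    ((Units.map (ι : PadicAlgCl p →* ℂ)).comp ψ.toMonoidHom)⁻¹ with hθdef
  have hθ : ∀ g : absoluteGaloisGroup K,
      ((θ g : ℂˣ) : ℂ) = (ι ((ψ g : (PadicAlgCl p)ˣ) : PadicAlgCl p))⁻¹ := fun g => by
    rw [hθdef, MonoidHom.inv_apply, Units.val_inv_eq_inv_val, MonoidHom.comp_apply,
      Units.coe_map]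
    rfl
  -- its kernel contains the open kernel of `ψ`
  have hkerle : ψ.toMonoidHom.ker ≤ θ.ker := fun g hg => by
    rw [MonoidHom.mem_ker] at hg ⊢
    rw [hθdef, MonoidHom.inv_apply, MonoidHom.comp_apply]
    change (Units.map (ι : PadicAlgCl p →* ℂ) (ψ.toMonoidHom g))⁻¹ = 1
    rw [hg, map_one, inv_one]
  have hker : IsOpen (θ.ker : Set (absoluteGaloisGroup K)) :=
    Subgroup.isOpen_mono hkerle (isOpen_ker_of_finite_range ψ)
  -- the rank-one framed Artin representation `Γ_K →ₜ* ℂˣ ≃ₜ* GL (Fin 1) ℂ`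
  refine ⟨ContinuousMonoidHom.comp
      (FramedRep.unitsContinuousMulEquivOfUnique (Fin 1) ℂ : ℂˣ →ₜ* GL (Fin 1) ℂ)
      ⟨θ, continuous_of_isOpen_ker θ hker⟩, fun g => ?_⟩
  rw [← hθ g]
  rfl

end Summit.Langlands.Langlands.Theorems.ArtinWeightRealisationLevel

end
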